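import Summits.QuantumFields.YangMills.Theorems.UnitScaleTiltFluctuationComparisonRegPrAnsatzSKernel

/-!
# Route `UnitScaleTilt` — crux K1bR-pr `FluctuationComparisonRegPr` (stmt-QuantumFields-19201), stub `stub_oneStepSmallLift`
# (W7 line), kernel data «ANSATZ S», part 2: THE FINE-PLAQUETTE ROWS — scalar inequalities, norm templates, the enumeration of `Orient 3`,
# and the orientation class `(0,1)` (support file `--supports stmt-QuantumFields-19201`)

Cell `ym3-torus` (rung R3), seat `ym3-torus-p2` gen 10 (CARD-19201-oneStepSmallLift-v3 §A; pre-checked in exact arithmetic against the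
tree's `rowFormC`/`succOff`/`bvec`/`kvec`/`d2` conventions for `L = 5, …, 21`: EVERY nonzero fine-plaquette row has `Σ|t − ∂e| = L/(5L−12)`).
For a fine plaquette class `(μ < ν, pp)` the first-order functional `[edge]·w(o_p; 0) + rowFormC pp μ ν w` of layer F5c evaluates, by
`AnsatzS.eval_row`, to: `0` if `x` exits in neither direction; a two-term difference `Δφ₀(q) • w o_p 0 + Δφ₋₁(q) • w o_p (−e)` if it exits
in exactly one (`q` = the other in-plane offset); and on the corner line (both exits) to
`[1 − 4(L−2)α + φ₀(q) − φ₋₁(q)] • w o_p 0 − φ₀(q) • w o_p (e_ρ) + φ₋₁(q) • w o_p (−e_ρ) + ε φ₀(q) • d₂w(0) + ε φ₋₁(q) • d₂w(−e_ρ)`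
(`ρ` the normal direction, `q = p_ρ`, `ε = ±1` the sign of `(μνρ)`) — the cross-talk with the `(μρ)`/`(νρ)` couplings is EXACTLY a coarse
2-boundary (`ApproxLift.d2`) plus `(μν)`-terms.

* §1 the scalar inequalities: single-exit `|Δφ₀(q)| + |Δφ₋₁(q)| ≤ Lα`; corner line `|1 − 4(L−2)α + φ₀ − φ₋₁| + |φ₀| + |φ₋₁| ≤ Lα` and
  Bianchi mass `|φ₀| + |φ₋₁| ≤ (L−2)α` (`L ≥ 5`);
* §2 norm templates, `Σ_{Orient 3}` as three terms, small vector facts;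
* §3 the `d = 3` literal parameters `P3` (so that `P.d`, `P.L` compute) and **`row01`**: the bound `Lα·B_w + (L−2)α·B_d` for orientation `(0,1)`.
  Orientations `(0,2)`, `(1,2)`, the `RowBound` and the per-`L` clause are in `…AnsatzSRowBound`.

Elementary; nothing of Bałaban's is asserted.
-/

noncomputable section

open scoped BigOperators Matrix.Norms.L2Operator
open NormedSpace

namespace Summit.QuantumFields.YangMills.Theorems.ApproxLift.AnsatzS

open Literature.MathematicalPhysics.QuantumFieldTheory.Balaban1983to89
open Literature.MathematicalPhysics.QuantumFieldTheory.Balaban1983to89.T3ContinuumYM3Torus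
open T4Continuum BlockAveraging

/-! ## §1 The scalar inequalities -/

/-- Single-exit rows: `|φ₀(q) − φ₀(q+1)| + |φ₋₁(q) − φ₋₁(q+1)| ≤ L·α` for `q + 2 ≤ L`, `L ≥ 5`. -/
theorem single_coeff_le {L q : ℕ} (hL : 5 ≤ L) (hq : q + 2 ≤ L) :
    |phi0 L q - phi0 L (q + 1)| + |phim1 L q - phim1 L (q + 1)| ≤ (L : ℝ) * alpha L := by
  have ha := alpha_pos (by omega : 3 ≤ L)
  have h5 : (5 : ℝ) ≤ L := by exact_mod_cast hL
  rcases Nat.eq_zero_or_pos q with rfl | hq0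
  · rw [phi0_zero, phim1_zero, phi0_mid (by omega) (by omega), phim1_mid (by omega) (by omega),
      abs_of_nonpos (by linarith), abs_of_nonneg (by nlinarith)]
    nlinarith
  · by_cases hq2 : q + 2 = L
    · rw [phi0_mid (by omega) (by omega), phim1_mid (by omega) (by omega), show q + 1 = L - 1 by omega,
        phi0_last (by omega), phim1_last (by omega), abs_of_nonneg (by nlinarith), abs_of_nonpos (by linarith)]
      nlinarith
    · rw [phi0_mid (by omega) (by omega), phim1_mid (by omega) (by omega), phi0_mid (by omega) (by omega),
        phim1_mid (by omega) (by omega), sub_self, sub_self, abs_zero, add_zero]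
      nlinarith

/-- Corner-line rows, `w`-part: `|1 − 4(L−2)α + φ₀(q) − φ₋₁(q)| + |φ₀(q)| + |φ₋₁(q)| ≤ L·α` for `q < L`, `L ≥ 5`. -/
theorem corner_coeff_le {L q : ℕ} (hL : 5 ≤ L) (hq : q < L) :
    |1 - 4 * (((L : ℝ) - 2) * alpha L) + phi0 L q - phim1 L q| + |phi0 L q| + |phim1 L q| ≤ (L : ℝ) * alpha L := by
  have ha := alpha_pos (by omega : 3 ≤ L)
  have h5 : (5 : ℝ) ≤ L := by exact_mod_cast hL
  rw [one_sub_four_mul_alpha (by omega)]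
  rcases Nat.eq_zero_or_pos q with rfl | hq0
  · rw [phi0_zero, phim1_zero, abs_zero, abs_of_nonpos (by nlinarith), abs_of_nonneg (by nlinarith)]
    nlinarith
  · by_cases hq1 : q = L - 1
    · rw [hq1, phi0_last (by omega), phim1_last (by omega), abs_zero, abs_of_nonpos (by nlinarith), abs_of_nonpos (by nlinarith)]
      nlinarith
    · rw [phi0_mid (by omega) hq1, phim1_mid (by omega) hq1, abs_of_nonneg (by nlinarith), abs_of_pos ha,
        abs_of_nonpos (by linarith)]
      nlinarith

/-- Corner-line rows, Bianchi part: `|φ₀(q)| + |φ₋₁(q)| ≤ (L−2)·α` for `q < L`, `L ≥ 5`. -/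
theorem corner_chain_le {L q : ℕ} (hL : 5 ≤ L) (hq : q < L) :
    |phi0 L q| + |phim1 L q| ≤ ((L : ℝ) - 2) * alpha L := by
  have ha := alpha_pos (by omega : 3 ≤ L)
  have h5 : (5 : ℝ) ≤ L := by exact_mod_cast hL
  rcases Nat.eq_zero_or_pos q with rfl | hq0
  · rw [phi0_zero, phim1_zero, abs_zero, zero_add, abs_of_nonneg (by nlinarith)]
  · by_cases hq1 : q = L - 1
    · rw [hq1, phi0_last (by omega), phim1_last (by omega), abs_zero, add_zero, abs_neg, abs_of_nonneg (by nlinarith)]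
    · rw [phi0_mid (by omega) hq1, phim1_mid (by omega) hq1, abs_neg, abs_of_pos ha]
      nlinarith

/-! ## §2 Norm templates and the enumeration of `Orient 3` -/

section Norms

variable {M : Type*} [SeminormedAddCommGroup M] [NormedSpace ℂ M]

/-- `‖(x : ℂ) • X‖ = |x|·‖X‖` for a real coefficient. -/
theorem norm_cast_smul (x : ℝ) (X : M) : ‖((x : ℝ) : ℂ) • X‖ = |x| * ‖X‖ := by
  rw [norm_smul, Complex.norm_real, Real.norm_eq_abs]

/-- Two terms against one bound. -/
theorem norm_two_le {a b Bw : ℝ} {X Y : M} (hX : ‖X‖ ≤ Bw) (hY : ‖Y‖ ≤ Bw) :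
    ‖((a : ℝ) : ℂ) • X + ((b : ℝ) : ℂ) • Y‖ ≤ (|a| + |b|) * Bw := by
  refine (norm_add_le _ _).trans ?_
  rw [norm_cast_smul, norm_cast_smul, add_mul]
  gcongr

/-- Five terms against two bounds. -/
theorem norm_five_le {c₀ c₁ c₂ e₀ e₁ Bw Bd : ℝ} {X₀ X₁ X₂ D₀ D₁ : M} (h₀ : ‖X₀‖ ≤ Bw) (h₁ : ‖X₁‖ ≤ Bw) (h₂ : ‖X₂‖ ≤ Bw)
    (hD₀ : ‖D₀‖ ≤ Bd) (hD₁ : ‖D₁‖ ≤ Bd) :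
    ‖((c₀ : ℝ) : ℂ) • X₀ + ((c₁ : ℝ) : ℂ) • X₁ + ((c₂ : ℝ) : ℂ) • X₂ + ((e₀ : ℝ) : ℂ) • D₀ + ((e₁ : ℝ) : ℂ) • D₁‖ ≤
      (|c₀| + |c₁| + |c₂|) * Bw + (|e₀| + |e₁|) * Bd := by
  have t₄ := norm_add_le (((c₀ : ℝ) : ℂ) • X₀ + ((c₁ : ℝ) : ℂ) • X₁ + ((c₂ : ℝ) : ℂ) • X₂ + ((e₀ : ℝ) : ℂ) • D₀) (((e₁ : ℝ) : ℂ) • D₁)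
  have t₃ := norm_add_le (((c₀ : ℝ) : ℂ) • X₀ + ((c₁ : ℝ) : ℂ) • X₁ + ((c₂ : ℝ) : ℂ) • X₂) (((e₀ : ℝ) : ℂ) • D₀)
  have t₂ := norm_add_le (((c₀ : ℝ) : ℂ) • X₀ + ((c₁ : ℝ) : ℂ) • X₁) (((c₂ : ℝ) : ℂ) • X₂)
  have t₁ := norm_add_le (((c₀ : ℝ) : ℂ) • X₀) (((c₁ : ℝ) : ℂ) • X₁)
  have s₀ : ‖((c₀ : ℝ) : ℂ) • X₀‖ = |c₀| * ‖X₀‖ := norm_cast_smul _ _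
  have s₁ : ‖((c₁ : ℝ) : ℂ) • X₁‖ = |c₁| * ‖X₁‖ := norm_cast_smul _ _
  have s₂ : ‖((c₂ : ℝ) : ℂ) • X₂‖ = |c₂| * ‖X₂‖ := norm_cast_smul _ _
  have s₃ : ‖((e₀ : ℝ) : ℂ) • D₀‖ = |e₀| * ‖D₀‖ := norm_cast_smul _ _
  have s₄ : ‖((e₁ : ℝ) : ℂ) • D₁‖ = |e₁| * ‖D₁‖ := norm_cast_smul _ _
  have g₀ := mul_le_mul_of_nonneg_left h₀ (abs_nonneg c₀)
  have g₁ := mul_le_mul_of_nonneg_left h₁ (abs_nonneg c₁)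
  have g₂ := mul_le_mul_of_nonneg_left h₂ (abs_nonneg c₂)
  have g₃ := mul_le_mul_of_nonneg_left hD₀ (abs_nonneg e₀)
  have g₄ := mul_le_mul_of_nonneg_left hD₁ (abs_nonneg e₁)
  linarith

end Norms

/-- The orientations `(μ < ν)` of `d = 3`. -/
theorem orient_cases : ∀ μ ν : Fin 3, μ < ν → (μ = 0 ∧ ν = 1) ∨ (μ = 0 ∧ ν = 2) ∨ (μ = 1 ∧ ν = 2) := by decide

/-- `(0,1)`. -/
abbrev o01 : Orient 3 := ⟨(0, 1), by decide⟩
/-- `(0,2)`. -/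
abbrev o02 : Orient 3 := ⟨(0, 2), by decide⟩
/-- `(1,2)`. -/
abbrev o12 : Orient 3 := ⟨(1, 2), by decide⟩

/-- `Orient 3 = {(0,1), (0,2), (1,2)}`. -/
theorem univ_orient3 : (Finset.univ : Finset (Orient 3)) = {o01, o02, o12} := by decide

/-- `Σ_{o : Orient 3} f o = f(0,1) + f(0,2) + f(1,2)`. -/
theorem sum_orient3 {M : Type*} [AddCommMonoid M] (f : Orient 3 → M) : ∑ o, f o = f o01 + f o02 + f o12 := by
  rw [univ_orient3, Finset.sum_insert (by decide), Finset.sum_insert (by decide), Finset.sum_singleton, add_assoc]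

/-- `0 ≠ 1` in `Fin 3`, as a rewrite rule. -/
theorem f01 : ((0 : Fin 3) = 1) ↔ False := by decide
/-- `0 ≠ 2` in `Fin 3`, as a rewrite rule. -/
theorem f02 : ((0 : Fin 3) = 2) ↔ False := by decide
/-- `1 ≠ 0` in `Fin 3`, as a rewrite rule. -/
theorem f10 : ((1 : Fin 3) = 0) ↔ False := by decide
/-- `1 ≠ 2` in `Fin 3`, as a rewrite rule. -/
theorem f12 : ((1 : Fin 3) = 2) ↔ False := by decide
/-- `2 ≠ 0` in `Fin 3`, as a rewrite rule. -/
theorem f20 : ((2 : Fin 3) = 0) ↔ False := by decide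
/-- `2 ≠ 1` in `Fin 3`, as a rewrite rule. -/
theorem f21 : ((2 : Fin 3) = 1) ↔ False := by decide

/-- `bvec true a = e_a`. -/
theorem bvec_true {d : ℕ} (a : Fin d) : bvec true a = unitZ a := by funext i; simp [bvec, unitZ]
/-- `bvec false a = 0`. -/
theorem bvec_false {d : ℕ} (a : Fin d) : bvec false a = 0 := by funext i; simp [bvec]
/-- `|0|∞ ≤ 2`. -/
theorem natAbs_zero_apply {d : ℕ} (i : Fin d) : ((0 : Fin d → ℤ) i).natAbs ≤ 1 + 1 := by simp
/-- `|−e_a|∞ ≤ 2`. -/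
theorem natAbs_neg_unitZ_apply {d : ℕ} (a i : Fin d) : ((-unitZ a) i).natAbs ≤ 1 + 1 := by
  simp only [Pi.neg_apply, unitZ]; split_ifs <;> simp

/-! ## §3 The three orientation classes -/

/-- The `d = 3` parameters with block size `L` (reducible, so that `P.d` and `P.L` compute). -/
abbrev P3 (L m K : ℕ) (hL : Odd L ∧ 1 < L) : Params := ⟨3, L, m, K, by norm_num, hL⟩

section Rows

variable {n : Type*} [Fintype n] [DecidableEq n]
variable {L m K : ℕ} {hL : Odd L ∧ 1 < L}

/-- The `μ`-offset of `x + e_μ` is `(p_μ + 1) mod L`. -/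
theorem succOff_val_self (pp : Fin 3 → Fin L) (μ : Fin 3) :
    ((succOff (P := P3 L m K hL) pp μ μ : Fin L) : ℕ) = ((pp μ : ℕ) + 1) % L := by
  simp [succOff]

/-- The other offsets of `x + e_μ` are those of `x`. -/
theorem succOff_ne (pp : Fin 3 → Fin L) {i μ : Fin 3} (h : i ≠ μ) : succOff (P := P3 L m K hL) pp μ i = pp i := by
  simp [succOff, Function.update_of_ne h]

/-- Orientation `(0,1)` (normal direction `2`, `ε = +1`). -/
theorem row01 (hL5 : 5 ≤ L) (pp : Fin 3 → Fin L) (w : Orient 3 → (Fin 3 → ℤ) → Matrix n n ℂ) {Bw Bd : ℝ}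
    (hw : ∀ o s, ‖w o s‖ ≤ Bw)
    (hd : ∀ s : Fin 3 → ℤ, (∀ i, (s i).natAbs ≤ 1 + 1) → ‖d2 w 0 1 2 o01.2 o12.2 s‖ ≤ Bd) (hBw : 0 ≤ Bw) (hBd : 0 ≤ Bd)
    (h : (0 : Fin 3) < 1) :
    ‖(if exbC (P := P3 L m K hL) pp 0 = true ∧ exbC (P := P3 L m K hL) pp 1 = true then w ⟨(0, 1), h⟩ 0 else 0) +
        rowFormC (P := P3 L m K hL) 1 (kzS (P3 L m K hL)) pp 0 1 w‖ ≤
      ((L : ℝ) * alpha L) * Bw + (((L : ℝ) - 2) * alpha L) * Bd := by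
  have hL3 : 3 ≤ L := by omega
  have h5 : (5 : ℝ) ≤ L := by exact_mod_cast hL5
  have hα := (alpha_pos hL3).le
  have hl0 : 0 ≤ (L : ℝ) * alpha L * Bw := mul_nonneg (mul_nonneg (by positivity) hα) hBw
  have hb0 : 0 ≤ ((L : ℝ) - 2) * alpha L * Bd := mul_nonneg (mul_nonneg (by linarith) hα) hBd
  have hq2 : ((pp 2 : Fin L) : ℕ) < L := (pp 2).isLt
  rw [rowFormC, eval_row₀, eval_row, eval_row, eval_row₀]
  simp only [sum_orient3, f01, f02, f10, f12, if_true, if_false, sub_zero, zero_sub, add_zero]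
  rw [succOff_ne pp (show (1 : Fin 3) ≠ 0 by decide), succOff_ne pp (show (2 : Fin 3) ≠ 0 by decide),
    succOff_ne pp (show (0 : Fin 3) ≠ 1 by decide), succOff_ne pp (show (2 : Fin 3) ≠ 1 by decide),
    succOff_val_self, succOff_val_self]
  by_cases ex0 : ((pp 0 : Fin L) : ℕ) = L - 1
  · have hm0 : (L - 1 + 1) % L = 0 := by rw [Nat.sub_add_cancel (by omega), Nat.mod_self]
    by_cases ex1 : ((pp 1 : Fin L) : ℕ) = L - 1
    · -- corner line
      simp only [exbC, ex0, ex1, hm0, decide_true, and_self, if_true, bvec_true, phi0_zero, phim1_zero, phi0_last hL3,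
        phim1_last hL3, Complex.ofReal_zero, zero_smul, zero_add, add_zero, sub_self, Complex.ofReal_neg, neg_smul]
      refine (congrArg norm (?_ : _ =
        (((1 - 4 * (((L : ℝ) - 2) * alpha L) + phi0 L (pp 2) - phim1 L (pp 2) : ℝ)) : ℂ) • w o01 0 +
        (((-phi0 L (pp 2) : ℝ)) : ℂ) • w o01 (unitZ 2) + ((phim1 L (pp 2) : ℝ) : ℂ) • w o01 (-unitZ 2) +
        ((phi0 L (pp 2) : ℝ) : ℂ) • d2 w 0 1 2 o01.2 o12.2 0 +
        ((phim1 L (pp 2) : ℝ) : ℂ) • d2 w 0 1 2 o01.2 o12.2 (-unitZ 2))).trans_le ?_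
      · simp only [d2, zero_add, sub_eq_neg_add, neg_add_cancel]
        push_cast
        module
      · refine (norm_five_le (hw _ _) (hw _ _) (hw _ _) (hd _ natAbs_zero_apply) (hd _ (natAbs_neg_unitZ_apply 2))).trans ?_
        have h1 := corner_coeff_le hL5 hq2
        have h2 := corner_chain_le hL5 hq2
        rw [abs_neg]
        exact add_le_add (mul_le_mul_of_nonneg_right h1 hBw) (mul_le_mul_of_nonneg_right h2 hBd)
    · -- exit in direction 0 only
      have hq : ((pp 1 : Fin L) : ℕ) + 2 ≤ L := by have := (pp 1).isLt; omega
      have hm1 : (((pp 1 : Fin L) : ℕ) + 1) % L = ((pp 1 : Fin L) : ℕ) + 1 := Nat.mod_eq_of_lt (by omega)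
      simp only [exbC, ex0, ex1, hm1, decide_true, decide_false, Bool.false_eq_true, and_false, if_true, if_false, bvec_false,
        zero_add, sub_zero, zero_sub]
      refine (congrArg norm (?_ : _ =
        ((phi0 L (pp 1) - phi0 L ((pp 1 : ℕ) + 1) : ℝ) : ℂ) • w o01 0 +
        ((phim1 L (pp 1) - phim1 L ((pp 1 : ℕ) + 1) : ℝ) : ℂ) • w o01 (-unitZ 1))).trans_le ?_
      · push_cast
        module
      · exact (norm_two_le (hw _ _) (hw _ _)).trans
          ((mul_le_mul_of_nonneg_right (single_coeff_le hL5 hq) hBw).trans (le_add_of_nonneg_right hb0))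
  · by_cases ex1 : ((pp 1 : Fin L) : ℕ) = L - 1
    · -- exit in direction 1 only
      have hq : ((pp 0 : Fin L) : ℕ) + 2 ≤ L := by have := (pp 0).isLt; omega
      have hm1 : (((pp 0 : Fin L) : ℕ) + 1) % L = ((pp 0 : Fin L) : ℕ) + 1 := Nat.mod_eq_of_lt (by omega)
      simp only [exbC, ex0, ex1, hm1, decide_true, decide_false, Bool.false_eq_true, false_and, if_true, if_false, bvec_false,
        zero_add, sub_zero, zero_sub]
      refine (congrArg norm (?_ : _ =
        ((phi0 L (pp 0) - phi0 L ((pp 0 : ℕ) + 1) : ℝ) : ℂ) • w o01 0 +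
        ((phim1 L (pp 0) - phim1 L ((pp 0 : ℕ) + 1) : ℝ) : ℂ) • w o01 (-unitZ 0))).trans_le ?_
      · push_cast
        module
      · exact (norm_two_le (hw _ _) (hw _ _)).trans
          ((mul_le_mul_of_nonneg_right (single_coeff_le hL5 hq) hBw).trans (le_add_of_nonneg_right hb0))
    · -- interior plaquette
      simp only [exbC, ex0, ex1, decide_false, Bool.false_eq_true, false_and, if_false, zero_add, sub_zero, norm_zero]
      exact add_nonneg hl0 hb0

end Rows

end Summit.QuantumFields.YangMills.Theorems.ApproxLift.AnsatzS

end
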